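import Mathlib
import Summits.ValiantsHypothesis.ValiantsHypothesis.Theses.GirthSidon

/-!
# GirthSidon — echelon lemma and quadratic spans in `K((t))`
(helper lemmas for the crux `MomentCurveElusive`, item `stmt-ValiantsHypothesis-6534`,
line `registered` / `Lines/birth.lean`, stub `stub_swallowedInSmallSumset`; part 1 of 2 —
part 2 is `GirthSidonMomentCurveElusiveBornBudget.lean`)

Setting of the load-bearing stub: Laurent series `y₁, …, y_s ∈ ℂ((t))`, a quadratic map
`Γ : ℂ^s → ℂ^m` (coordinates of total degree `≤ 2`) and an injective exponent vector
`D : Fin m → ℕ` with `Γ_i(y) = t^{D_i}` for all `i` ("formal swallowing"), `V = span_ℂ(1, y₁, …, y_s)`.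
This file holds the linear-algebra bookkeeping in `K((t))` used by the cancellation budget of
part 2 (strategy census `Cruxes/MomentCurveElusive/STRATEGY-CENSUS.md`, §Strengthen S2):

* `linearIndependent_of_order_injective`, `card_le_finrank_of_subset_orders`, `orders_finite`,
  `card_orders_eq_finrank` — **echelon lemma**: a finite-dimensional subspace `W ⊂ K((t))` has
  exactly `finrank W` orders of nonzero elements (elements of distinct orders are linearly
  independent; conversely a nonzero element all of whose coefficients at the orders of `W` vanish
  cannot exist);
* `exists_mul_self_le_finrank_le` — `V · V` sits in a space of dimension `≤ C(finrank V + 1, 2)`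
  (products of unordered pairs of a basis);
* `prod_pow_mem_mul_self_of_sum_le_two`, `aeval_mem_mul_self_of_totalDegree_le_two` — for `1 ∈ V`
  and `y_j ∈ V`, every `p(y)` with `p` of total degree `≤ 2` lies in `V · V` (so the stub's
  hypothesis `Γ_i(y) = t^{D_i}` puts `t^{D_i}` in `V · V`).

Here `V · V` is written `Submodule.span K (↑V * ↑V)` (span of the pointwise product of the
carrier sets): the `Submodule` product `V * V` would need `IsScalarTower K K((t)) K((t))`, which
instance search does not find for Hahn series in this Mathlib (the `K`-algebra structure of
`K((t))` goes through power series).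
-/

-- `Summit.ValiantsHypothesis.ValiantsHypothesis.…` is the tree's mandated single-conjunct layout
-- (Sub = Summit), so the duplicated namespace component is intended.
set_option linter.dupNamespace false

namespace Summit.ValiantsHypothesis.ValiantsHypothesis.Theorems

open scoped Pointwise

section Echelon

variable {K : Type*} [Field K]

/-- Nonzero Laurent series with pairwise distinct `t`-orders are linearly independent: in a
vanishing linear combination, look at the coefficient at the smallest order carrying a nonzero
scalar. [folklore] -/
theorem linearIndependent_of_order_injective {ι : Type*} (w : ι → LaurentSeries K)
    (hw : ∀ i, w i ≠ 0) (hinj : Function.Injective fun i => (w i).order) :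
    LinearIndependent K w := by
  classical
  rw [linearIndependent_iff']
  intro S c hc
  by_contra hex
  push Not at hex
  obtain ⟨i, hi, hci⟩ := hex
  set T := S.filter fun j => c j ≠ 0 with hT
  have hTne : T.Nonempty := ⟨i, Finset.mem_filter.2 ⟨hi, hci⟩⟩
  obtain ⟨j₀, hj₀, hmin⟩ := T.exists_min_image (fun j => (w j).order) hTne
  have hj₀S : j₀ ∈ S := (Finset.mem_filter.1 hj₀).1
  have hcj₀ : c j₀ ≠ 0 := (Finset.mem_filter.1 hj₀).2
  have hcoef := congr_arg (fun x : LaurentSeries K => x.coeff (w j₀).order) hc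
  simp only [HahnSeries.coeff_sum, HahnSeries.coeff_smul, HahnSeries.coeff_zero] at hcoef
  rw [Finset.sum_eq_single j₀] at hcoef
  · exact (mul_ne_zero hcj₀ (HahnSeries.coeff_order_eq_zero.not.2 (hw j₀))) (by simpa using hcoef)
  · intro j hjS hj
    by_cases hcj : c j = 0
    · simp [hcj]
    · have hjT : j ∈ T := Finset.mem_filter.2 ⟨hjS, hcj⟩
      have hle := hmin j hjT
      have hne : (w j₀).order ≠ (w j).order := fun h => hj (hinj h).symm
      have hlt : (w j₀).order < (w j).order := lt_of_le_of_ne hle hne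
      simp [HahnSeries.coeff_eq_zero_of_lt_order hlt]
  · intro h; exact absurd hj₀S h

/-- Any finite set of orders of nonzero elements of a finite-dimensional `W ⊂ K((t))` has at most
`finrank W` elements. [folklore] -/
theorem card_le_finrank_of_subset_orders (W : Submodule K (LaurentSeries K))
    [FiniteDimensional K W] (F : Finset ℤ) (hF : ↑F ⊆ {e : ℤ | ∃ v ∈ W, v ≠ 0 ∧ v.order = e}) :
    F.card ≤ Module.finrank K W := by
  classical
  have hF' : ∀ e ∈ F, ∃ v ∈ W, v ≠ 0 ∧ v.order = e := fun e he => hF (by simpa using he)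
  choose! v hvW hv0 hvo using hF'
  -- the family `e ↦ v e` (e ∈ F) in `W` is linearly independent
  let f : F → W := fun e => ⟨v e, hvW e e.2⟩
  have hli : LinearIndependent K f := by
    have hli' : LinearIndependent K (fun e : F => (f e : LaurentSeries K)) := by
      refine linearIndependent_of_order_injective _ (fun e => hv0 e e.2) ?_
      intro e e' h
      apply Subtype.ext
      have h1 := hvo e e.2
      have h2 := hvo e' e'.2
      simp only [f] at h
      rw [h1, h2] at h
      exact h
    exact LinearIndependent.of_comp W.subtype hli'
  simpa using hli.fintype_card_le_finrank

/-- The orders of nonzero elements of a finite-dimensional `W ⊂ K((t))` form a finite set.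
[folklore] -/
theorem orders_finite (W : Submodule K (LaurentSeries K)) [FiniteDimensional K W] :
    ({e : ℤ | ∃ v ∈ W, v ≠ 0 ∧ v.order = e}).Finite := by
  classical
  by_contra hinf
  obtain ⟨F, hF, hcard⟩ := Set.Infinite.exists_subset_card_eq hinf (Module.finrank K W + 1)
  have := card_le_finrank_of_subset_orders W F hF
  omega

/-- **Echelon lemma.** A finite-dimensional subspace `W ⊂ K((t))` has exactly `finrank W`
distinct orders of nonzero elements. (`≤`: distinct orders are independent; `≥`: otherwise the
map `v ↦ (coeff_e v)_{e ∈ orders}` has a nonzero kernel element, whose own order is one of the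
`e`.) [folklore] -/
theorem card_orders_eq_finrank (W : Submodule K (LaurentSeries K)) [FiniteDimensional K W] :
    (orders_finite W).toFinset.card = Module.finrank K W := by
  classical
  set F := (orders_finite W).toFinset with hFdef
  apply le_antisymm
  · exact card_le_finrank_of_subset_orders W F (by simp [hFdef])
  · -- the coefficient map `W → (F → K)` is injective
    let L : W →ₗ[K] (F → K) :=
      { toFun := fun v e => (v : LaurentSeries K).coeff e
        map_add' := fun v v' => by ext e; simp
        map_smul' := fun r v => by ext e; simp }
    have hinj : Function.Injective L := by
      rw [← LinearMap.ker_eq_bot, Submodule.eq_bot_iff]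
      intro v hv
      by_contra hv0
      have hv0' : (v : LaurentSeries K) ≠ 0 := fun h => hv0 (Subtype.ext h)
      have hmem : (v : LaurentSeries K).order ∈ F := by
        rw [hFdef, Set.Finite.mem_toFinset]
        exact ⟨v, v.2, hv0', rfl⟩
      have h := congr_fun (LinearMap.mem_ker.1 hv) ⟨_, hmem⟩
      simp only [LinearMap.coe_mk, AddHom.coe_mk, Pi.zero_apply, L] at h
      exact HahnSeries.coeff_order_eq_zero.not.2 hv0' h
    have := LinearMap.finrank_le_finrank_of_injective hinj
    simpa using this

/-- **Echelon lemma, registered helper form** (sub-goal `helper_echelonOrders` of item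
`stmt-ValiantsHypothesis-6534`): the order set of a finite-dimensional `W ⊂ ℂ((t))` is a finite
set with exactly `finrank W` elements. [folklore] -/
theorem helper_echelonOrders : ∀ (W : Submodule ℂ (LaurentSeries ℂ)) [FiniteDimensional ℂ W], ∃ O : Finset ℤ, (↑O = {e : ℤ | ∃ v ∈ W, v ≠ 0 ∧ v.order = e}) ∧ O.card = Module.finrank ℂ W := by
  intro W _
  exact ⟨(orders_finite W).toFinset, by simp, card_orders_eq_finrank W⟩

end Echelon

section QuadraticSpan

variable {K : Type*} [Field K]

/-- Products of pairs from a finite-dimensional subspace `V ⊂ K((t))` lie in a subspace of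
dimension at most `C(finrank V + 1, 2)` (spanned by the products of unordered pairs of a basis).
[folklore] -/
theorem exists_mul_self_le_finrank_le (V : Submodule K (LaurentSeries K)) [FiniteDimensional K V] :
    ∃ W : Submodule K (LaurentSeries K), FiniteDimensional K W ∧ Submodule.span K ((V : Set (LaurentSeries K)) * (V : Set (LaurentSeries K))) ≤ W ∧
      Module.finrank K W ≤ (Module.finrank K V + 1).choose 2 := by
  classical
  set n := Module.finrank K V
  let b := Module.finBasis K V
  let f : Sym2 (Fin n) → LaurentSeries K :=
    Sym2.lift ⟨fun j k => (b j : LaurentSeries K) * b k, fun j k => mul_comm _ _⟩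
  let S : Finset (LaurentSeries K) := (Finset.univ : Finset (Fin n)).sym2.image f
  refine ⟨Submodule.span K (S : Set (LaurentSeries K)), inferInstance, ?_, ?_⟩
  · rw [Submodule.span_le]
    rintro _ ⟨v, hv, v', hv', rfl⟩
    change v * v' ∈ Submodule.span K (S : Set (LaurentSeries K))
    have hexp : ∀ (w : LaurentSeries K) (hw : w ∈ V),
        w = ∑ j, b.repr ⟨w, hw⟩ j • (b j : LaurentSeries K) := by
      intro w hw
      have h := congr_arg (fun x : V => (x : LaurentSeries K)) (b.sum_repr ⟨w, hw⟩)
      simp only [Submodule.coe_sum, Submodule.coe_smul] at h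
      exact h.symm
    have hv_eq := hexp v hv
    have hv'_eq := hexp v' hv'
    rw [hv_eq, hv'_eq, Finset.sum_mul]
    refine Submodule.sum_mem _ fun j _ => ?_
    rw [Finset.mul_sum]
    refine Submodule.sum_mem _ fun k _ => ?_
    have hsm : (b.repr ⟨v, hv⟩ j • (b j : LaurentSeries K)) *
          (b.repr ⟨v', hv'⟩ k • (b k : LaurentSeries K))
        = (b.repr ⟨v, hv⟩ j * b.repr ⟨v', hv'⟩ k) • ((b j : LaurentSeries K) * b k) := by
      rw [← HahnSeries.C_mul_eq_smul, ← HahnSeries.C_mul_eq_smul, ← HahnSeries.C_mul_eq_smul,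
        map_mul]
      ring
    rw [hsm]
    refine Submodule.smul_mem _ _ (Submodule.subset_span ?_)
    simp only [S, Finset.coe_image, Set.mem_image, Finset.mem_coe]
    exact ⟨s(j, k), by simp, rfl⟩
  · calc Module.finrank K (Submodule.span K (S : Set (LaurentSeries K))) ≤ S.card :=
          finrank_span_finset_le_card S
      _ ≤ (Finset.univ : Finset (Fin n)).sym2.card := Finset.card_image_le
      _ = (n + 1).choose 2 := by rw [Finset.card_sym2, Finset.card_univ, Fintype.card_fin]

/-- Products `∏_{j ∈ T} y_j^{e_j}` of total weight `≤ 2` of elements `y_j` of a subspace `V ∋ 1`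
lie in `V · V` (bookkeeping by induction on `T`, tracking weights `0`, `≤ 1`, `≤ 2`). [folklore] -/
theorem prod_pow_mem_mul_self_of_sum_le_two {σ : Type*} (y : σ → LaurentSeries K)
    (V : Submodule K (LaurentSeries K)) (h1 : (1 : LaurentSeries K) ∈ V) (hy : ∀ j, y j ∈ V)
    (e : σ → ℕ) (T : Finset σ) (hT : ∑ j ∈ T, e j ≤ 2) :
    (∏ j ∈ T, y j ^ e j) ∈ Submodule.span K ((V : Set (LaurentSeries K)) * (V : Set (LaurentSeries K))) := by
  classical
  suffices H : (∑ j ∈ T, e j = 0 → ∏ j ∈ T, y j ^ e j = 1) ∧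
      (∑ j ∈ T, e j ≤ 1 → (∏ j ∈ T, y j ^ e j) ∈ V) ∧
      (∑ j ∈ T, e j ≤ 2 → (∏ j ∈ T, y j ^ e j) ∈ Submodule.span K ((V : Set (LaurentSeries K)) * (V : Set (LaurentSeries K)))) from H.2.2 hT
  clear hT
  induction T using Finset.induction_on with
  | empty =>
    refine ⟨fun _ => by simp, fun _ => by simpa using h1, fun _ => ?_⟩
    simpa using Submodule.subset_span (Set.mul_mem_mul h1 h1)
  | insert a T ha ih =>
    obtain ⟨ih0, ih1, ih2⟩ := ih
    rw [Finset.sum_insert ha, Finset.prod_insert ha]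
    refine ⟨fun h => ?_, fun h => ?_, fun h => ?_⟩
    · have hea : e a = 0 := by omega
      rw [hea, pow_zero, one_mul, ih0 (by omega)]
    · rcases Nat.lt_or_ge (e a) 1 with hlt | hge
      · have hea : e a = 0 := by omega
        rw [hea, pow_zero, one_mul]
        exact ih1 (by omega)
      · have hea : e a = 1 := by omega
        rw [hea, pow_one, ih0 (by omega), mul_one]
        exact hy a
    · rcases Nat.lt_or_ge (e a) 1 with hlt | hge
      · have hea : e a = 0 := by omega
        rw [hea, pow_zero, one_mul]
        exact ih2 (by omega)
      · rcases Nat.lt_or_ge (e a) 2 with hlt2 | hge2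
        · have hea : e a = 1 := by omega
          rw [hea, pow_one]
          exact Submodule.subset_span (Set.mul_mem_mul (hy a) (ih1 (by omega)))
        · have hea : e a = 2 := by omega
          rw [hea, ih0 (by omega), mul_one, pow_two]
          exact Submodule.subset_span (Set.mul_mem_mul (hy a) (hy a))

/-- For a polynomial `p` of total degree `≤ 2` and elements `y_j` of a subspace `V ∋ 1` of
`K((t))`, the value `p(y)` lies in `V · V`. [folklore] -/
theorem aeval_mem_mul_self_of_totalDegree_le_two {σ : Type*} (y : σ → LaurentSeries K)
    (V : Submodule K (LaurentSeries K)) (h1 : (1 : LaurentSeries K) ∈ V) (hy : ∀ j, y j ∈ V)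
    (p : MvPolynomial σ K) (hp : p.totalDegree ≤ 2) :
    MvPolynomial.aeval y p ∈ Submodule.span K ((V : Set (LaurentSeries K)) * (V : Set (LaurentSeries K))) := by
  classical
  rw [p.as_sum, map_sum (MvPolynomial.aeval y)]
  refine Submodule.sum_mem _ fun d hd => ?_
  rw [MvPolynomial.aeval_monomial]
  -- `algebraMap K K((t))` (through power series) is `HahnSeries.C`, and `C c * x = c • x`
  have hC : algebraMap K (LaurentSeries K) (MvPolynomial.coeff d p) =
      HahnSeries.C (MvPolynomial.coeff d p) := by
    rw [HahnSeries.algebraMap_apply']; simp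
  rw [hC, HahnSeries.C_mul_eq_smul]
  refine Submodule.smul_mem _ _ ?_
  have hdeg : (d.sum fun _ e => e) ≤ 2 := le_trans (MvPolynomial.le_totalDegree hd) hp
  exact prod_pow_mem_mul_self_of_sum_le_two y V h1 hy d d.support hdeg

end QuadraticSpan

end Summit.ValiantsHypothesis.ValiantsHypothesis.Theorems
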